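import Mathlib
import HarnessLib
import Summits.HubbardSuperconductivity.HubbardSuperconductivity.Theorems.KLProgrammeKLRegimeBetaSplitV10S
import Summits.HubbardSuperconductivity.HubbardSuperconductivity.Theorems.KLProgrammeKLRegimeBetaSplitEdgeF
import Summits.HubbardSuperconductivity.HubbardSuperconductivity.Theorems.KLProgrammeKLRegimeSplitLegCountFlow

/-!
# Route `KLProgramme` — crux K3 gen 8, CHILD 1 `KLRegimeBetaSplitV17F2 := BetaSplitP klPredsV17F2 klWindowC` (stmt-HubbardSuperconductivity-20438) at SLOT level:
# `betaSplitP_of_slotsV17F2` (split ⇐ `BetaSplitAtV17F`, engine ⇒ `EngineBoundsAtV17F2`, renorm ⇒ `FlowPieceJetsAt`) and the bundle instance `betaSplitP_klPredsV17F2`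

Cell gate-hubbard-kl, seat hubbard-kl-k3c1-p1 (g8; child-1 lineage; technique «composed-map remainder propagation»).  This is `betaSplitP_of_slotsV10S` (k3c2-p3 p508183 ←
k3c1-p1 `betaSplitP_of_slotsV9S` p488227) carried to the flowing-dispersion scheme F-II of the K3-FLOW ruling (KL STATUS 2026-08-27T10:17Z; texts `…SplitSlotsV17F` p524744 /
cured `…SplitSlotsV17F2` p527694; gen-8 items rev 22), following k3c1-p2's CHILD1-FLOW-PORT.md §4 (evidence #32/#35 on stmt-…-20236) over the F-wrapper
`betaSplitP_of_edgeClausesF` (`…BetaSplitEdgeF`).  What is NEW relative to V10S — the remainder of the COMPOSED cross-frame ladder, propagated with child 1's constants: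

* §1 the FRAME-RATE LAW of the flow frames from the history's (I-F jets): `frameDist K_{j+1} K_j ≤ Gfr₀·|U|·4^{−2j}` (p2's `abs_evalM_klFlowFrameU_sub_le`;
  cf. k3c2-p2's `frameDist_klFlowFrameU_succ_le(_rate)`, p533661), hence `≤ (1/32)·Λ_j` once `32·Gfr₀·|U| ≤ klE0` — for the sequence FROZEN above `n`
  (`frameDist_klFlowFrameU_trunc_le`), so that
  k3c1-p2's moving-frame count `legDressBarQ2_countT_flow_sum_le` (p521177, constant `20` unchanged) applies with the rate known only BELOW `n`
  (`legDressBarQ2_countT_flowFrameU_sum_le`);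
* §2 **`betaSplitP_of_slotsV17F2`**: the extra family is V10S's `thermalBar + legDressBarQ2·(count) + (Klam U)²·(ph gains)⁺` with the count read at the RUNNING frame
  `K_j` plus the frame-shift allowance `frameShiftBar P Q U j = Q.CR·(Klam U)²·4^{−j}` of the (E2-F2)/(E2″-F) budgets; numerals `(sG, sQ, tG, tQ, tN) = (3, 9, 10/3, 148/3, 15)`
  (V10S's `(3, 8, 10/3, 48, 15)` plus `frameShiftBar ≤ CR·Klam³U²` per scale and `Σ frameShiftBar ≤ (4/3)·CR·(Klam U)²` by `sum_frameShiftBar_le`; leg line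
  `12(tQ+sQ)+tQ = 749⅓ ≤ klLegKappa = 4000`); the `R`-level smallness `uR R := klE0/(32·Gfr₀+1)` feeds §1 (chosen after `R`, inside `U₀` — trap (γ) of the port memo);
  the history is read ONLY for `Pr.renorm … j ⇒ FlowPieceJetsAt … j` at `j < n` (hypothesis `hr`);
* §3 **`betaSplitP_klPredsV17F2 W : BetaSplitP klPredsV17F2 W`** — the three slot maps are `id`, `id`, `∧`-projection (`klPredsV17F2.renorm = RenormFlowAtV17F ∋ FlowPieceJetsAt`).

The route closer `klRegimeBetaSplitV17F2_proof` (Theses name, `--workitem stmt-…-20438`) is the next (3-line) file.  Everything is proved; no definitions; nothing about the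
model is asserted (the engine/renorm slots are hypotheses of child 1 by the route's design); nothing asserts superconductivity.
-/

noncomputable section

namespace Summit.HubbardSuperconductivity.HubbardSuperconductivity.Theorems.KLRegimeSplit

set_option linter.dupNamespace false -- summit = problem name (single-conjunct summit), D-0017

open Real Finset Literature.MathematicalPhysics.QuantumLattice Literature.Probability.LatticeModels
open Summit.HubbardSuperconductivity.HubbardSuperconductivity.Theorems.KLProgrammeLegKernels
open Summit.HubbardSuperconductivity.HubbardSuperconductivity.Theorems.CooperChannelRiccatiFlow
open Summit.HubbardSuperconductivity.HubbardSuperconductivity.Theorems.DispersionFlow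

/-! ## §1 The frame-rate law of the flow frames and the (D) count along them -/

section Model

variable (L M : ℕ) [NeZero L] [NeZero M]

/-- One flow step moves the frame by at most the piece's sup: from (I-F jets) at every `m ≤ j`, `frameDist K_{j+1} K_j ≤ Gfr₀·|U|·4^{−2j}`
(`abs_evalM_klFlowFrameU_sub_le` between `j` and `j+1`, read on `Fin 2 → ℝ` through `WithLp.toLp`).  Private twin of k3c2-p2's
`frameDist_klFlowFrameU_succ_le` (`…EngineIsoTupleV17FDoor`, p533661), kept local so that child 1's chain does not import the (E5-F) door module. -/
private theorem klbsF_frameDist_succ_le {β U μ : ℝ} {R : RenConsts} {j : ℕ} (hJ : ∀ m ≤ j, FlowPieceJetsAt L M β U μ R m) :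
    frameDist (klFlowFrameU L M β U μ (j + 1)) (klFlowFrameU L M β U μ j) ≤ R.Gfr 0 * |U| * (4 : ℝ) ^ ((((0 : ℕ) : ℤ) - 2) * (j : ℤ)) := by
  refine frameDist_le_of_forall fun p => ?_
  have h := abs_evalM_klFlowFrameU_sub_le (L := L) (M := M) (Nat.le_add_right j 1) (fun m hm => hJ m (Nat.lt_succ_iff.mp hm)) (WithLp.toLp 2 p)
  rw [Nat.Ico_succ_singleton, sum_singleton] at h
  have hu : uPow 0 U = |U| := by simp [uPow]
  rw [hu] at h
  simpa only [evalM_apply, WithLp.ofLp_toLp] using h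

/-- **The frame-rate law for the flow sequence frozen above `n`**: with (I-F jets) at every `m < n`, `Gfr₀ ≥ 0` and `32·Gfr₀·|U| ≤ klE0`, the sequence
`j ↦ K_{min j n}` satisfies `frameDist K′_{j+1} K′_j ≤ (1/32)·Λ_j` at EVERY `j` (below `n`: `Gfr₀|U|4^{−2j} ≤ (klE0/32)·4^{−j}`; from `n` on the sequence is constant). -/
theorem frameDist_klFlowFrameU_trunc_le {β U μ : ℝ} {R : RenConsts} {n : ℕ} (hJ : ∀ m < n, FlowPieceJetsAt L M β U μ R m)
    (hGfr : 0 ≤ R.Gfr 0) (hU32 : 32 * R.Gfr 0 * |U| ≤ klE0) (j : ℕ) :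
    frameDist (klFlowFrameU L M β U μ (min (j + 1) n)) (klFlowFrameU L M β U μ (min j n)) ≤ 1 / 32 * klScale klE0 j := by
  rcases lt_or_ge j n with hj | hj
  · rw [Nat.min_eq_left (Nat.succ_le_of_lt hj), Nat.min_eq_left hj.le]
    refine (klbsF_frameDist_succ_le L M fun m hm => hJ m (lt_of_le_of_lt hm hj)).trans ?_
    have h4 : (4 : ℝ) ^ ((((0 : ℕ) : ℤ) - 2) * (j : ℤ)) ≤ ((4 : ℝ) ^ j)⁻¹ := by
      rw [show (((0 : ℕ) : ℤ) - 2) * (j : ℤ) = -((2 * j : ℕ) : ℤ) by push_cast; ring, zpow_neg, zpow_natCast]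
      exact inv_anti₀ (by positivity) (pow_le_pow_right₀ (by norm_num) (by omega))
    have hsc : klScale klE0 j = klE0 * ((4 : ℝ) ^ j)⁻¹ := rfl
    rw [hsc]
    have h0 : 0 ≤ R.Gfr 0 * |U| := mul_nonneg hGfr (abs_nonneg U)
    calc R.Gfr 0 * |U| * (4 : ℝ) ^ ((((0 : ℕ) : ℤ) - 2) * (j : ℤ)) ≤ R.Gfr 0 * |U| * ((4 : ℝ) ^ j)⁻¹ := mul_le_mul_of_nonneg_left h4 h0
      _ ≤ (1 / 32 * klE0) * ((4 : ℝ) ^ j)⁻¹ := mul_le_mul_of_nonneg_right (by linarith) (by positivity)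
      _ = 1 / 32 * (klE0 * ((4 : ℝ) ^ j)⁻¹) := by ring
  · rw [Nat.min_eq_right (by omega : n ≤ j + 1), Nat.min_eq_right hj, frameDist_self]
    exact mul_nonneg (by norm_num) (klth_klScale_pos j).le

/-- **(D) summed along the flow frames, rate read from the history below `n`**: with (I-F jets) at every `m < n`, `Gfr₀ ≥ 0`, `32·Gfr₀·|U| ≤ klE0`,
`Σ_{j ≤ n} legDressBarQ2 G P Q U j (legSliceCountT … K_j j k) ≤ 20·Q.CR·((Klam U)² + (Klam|U|)³)` — k3c1-p2's `legDressBarQ2_countT_flow_sum_le` (p521177) on the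
frozen sequence of `frameDist_klFlowFrameU_trunc_le`, which agrees with `K_j` on `j ≤ n`. -/
theorem legDressBarQ2_countT_flowFrameU_sum_le (G : GeoConsts) {P : SplitConsts} {Q : EngConsts} (hK : 0 ≤ P.Klam) (hQ : 0 ≤ Q.CR)
    {β U μ : ℝ} {R : RenConsts} {n : ℕ} (hJ : ∀ m < n, FlowPieceJetsAt L M β U μ R m) (hGfr : 0 ≤ R.Gfr 0)
    (hU32 : 32 * R.Gfr 0 * |U| ≤ klE0) (k : Fin 4 → TorusSite 2 L) :
    ∑ j ∈ range (n + 1), legDressBarQ2 G P Q U j (legSliceCountT L β μ (klFlowFrameU L M β U μ j) j k) ≤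
      20 * (Q.CR * ((P.Klam * U) ^ 2 + (P.Klam * |U|) ^ 3)) := by
  have h := legDressBarQ2_countT_flow_sum_le L G hK hQ U β μ (fun j => klFlowFrameU L M β U μ (min j n)) (κ := 1 / 32)
    (by norm_num) (by norm_num) (frameDist_klFlowFrameU_trunc_le L M hJ hGfr hU32) k n
  calc ∑ j ∈ range (n + 1), legDressBarQ2 G P Q U j (legSliceCountT L β μ (klFlowFrameU L M β U μ j) j k)
      = ∑ j ∈ range (n + 1), legDressBarQ2 G P Q U j (legSliceCountT L β μ (klFlowFrameU L M β U μ (min j n)) j k) :=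
        sum_congr rfl fun j hj => by rw [Nat.min_eq_left (Nat.lt_succ_iff.mp (mem_range.mp hj))]
    _ ≤ 20 * (Q.CR * ((P.Klam * U) ^ 2 + (P.Klam * |U|) ^ 3)) := h

/-- `U ≤ klE0/(32·Gfr₀ + 1)`, `0 ≤ U`, `0 ≤ Gfr₀` give the rate smallness `32·Gfr₀·|U| ≤ klE0`. -/
theorem klbsF_rate_smallness {U g : ℝ} (hU : 0 ≤ U) (hg : 0 ≤ g) (hUR : U ≤ klE0 / (32 * g + 1)) : 32 * g * |U| ≤ klE0 := by
  rw [abs_of_nonneg hU]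
  have hpos : 0 < 32 * g + 1 := by positivity
  have h1 : 32 * g * U ≤ (32 * g + 1) * U := by nlinarith
  have h2 : (32 * g + 1) * U ≤ (32 * g + 1) * (klE0 / (32 * g + 1)) := mul_le_mul_of_nonneg_left hUR hpos.le
  have h3 : (32 * g + 1) * (klE0 / (32 * g + 1)) = klE0 := by field_simp
  linarith

/-- `frameShiftBar P Q U j ≤ Q.CR·Klam³·U²` (`4^{−j} ≤ 1`, `Klam² ≤ Klam³` for `Klam ≥ 1`). -/
theorem frameShiftBar_le_cube {P : SplitConsts} {Q : EngConsts} (hP : 1 ≤ P.Klam) (hQ : 0 ≤ Q.CR) (U : ℝ) (j : ℕ) :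
    frameShiftBar P Q U j ≤ Q.CR * P.Klam ^ 3 * U ^ 2 := by
  unfold frameShiftBar
  have h4 : ((4 : ℝ)⁻¹) ^ j ≤ 1 := pow_le_one₀ (by norm_num) (by norm_num)
  have hK2 : P.Klam ^ 2 ≤ P.Klam ^ 3 := pow_le_pow_right₀ hP (by norm_num)
  have hU2 : 0 ≤ U ^ 2 := sq_nonneg U
  calc Q.CR * (P.Klam * U) ^ 2 * ((4 : ℝ)⁻¹) ^ j ≤ Q.CR * (P.Klam * U) ^ 2 * 1 := mul_le_mul_of_nonneg_left h4 (by positivity)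
    _ = Q.CR * (P.Klam ^ 2 * U ^ 2) := by ring
    _ ≤ Q.CR * (P.Klam ^ 3 * U ^ 2) := mul_le_mul_of_nonneg_left (mul_le_mul_of_nonneg_right hK2 hU2) hQ
    _ = Q.CR * P.Klam ^ 3 * U ^ 2 := by ring

/-- `Σ_{j<N} frameShiftBar P Q U j ≤ (4/3)·Q.CR·Klam³·U²`. -/
theorem sum_frameShiftBar_le_cube' {P : SplitConsts} {Q : EngConsts} (hP : 1 ≤ P.Klam) (hQ : 0 ≤ Q.CR) (U : ℝ) (N : ℕ) :
    ∑ j ∈ range N, frameShiftBar P Q U j ≤ 4 / 3 * (Q.CR * P.Klam ^ 3 * U ^ 2) := by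
  have h := sum_frameShiftBar_le_cube (P := P) (Q := Q) hP hQ U N
  linarith

end Model

/-! ## §2 Child 1 at slot level in scheme F-II -/

/-- **Child 1 at slot level for the cured scheme-F bundle texts, every bundle and window.**  If `BetaSplitAtV17F ⇒ Pr.split`, `Pr.engine ⇒ EngineBoundsAtV17F2` and
`Pr.renorm … R j ⇒ FlowPieceJetsAt … R j`, then `BetaSplitP Pr W`.  Proof = `betaSplitP_of_edgeClausesF` with the extra family
`thermalBar + legDressBarQ2·(legSliceCountT at K_j) + (Klam U)²·((phGain)⁺ + (phGain)⁺) + frameShiftBar` (at `1 ≤ j`; `legDressBarQ2 … 0 4` at `j = 0`), numerals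
`(sG, sQ, tG, tQ, tN) = (3, 9, 10/3, 148/3, 15)`, sign-defect allowance `2·klEdge`, `uR R = klE0/(32·Gfr₀+1)`; per-scale bounds as in V10S plus `frameShiftBar ≤ CR·Klam³U²`;
scale sums: thermal `≤ (4/3)CF(Klam U)²`, flowing (D) count `≤ 40·CR·Klam³U²` (§1, rate from `HistP`'s renorm slots below `n`), crossed gains `≤ 2CF(Klam U)²` (`G.WF`), frame shift
`≤ (4/3)·CR·Klam³U²`, scale-0 leg term `≤ 8·CR·Klam³U²`. -/
theorem betaSplitP_of_slotsV17F2 {Pr : Preds} {W : Set ℝ}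
    (hs : ∀ (L M : ℕ) [NeZero L] [NeZero M] (G : GeoConsts) (P : SplitConsts) (Q : EngConsts) (β U μ : ℝ) (K : TrigPolyC4v) (n : ℕ),
      BetaSplitAtV17F L M G P Q β U μ n → Pr.split L M G P Q β U μ K n)
    (he : ∀ (L M : ℕ) [NeZero L] [NeZero M] (G : GeoConsts) (P : SplitConsts) (Q : EngConsts) (β U μ : ℝ) (K : TrigPolyC4v) (n : ℕ),
      Pr.engine L M G P Q β U μ K n → EngineBoundsAtV17F2 L M G P Q β U μ n)
    (hr : ∀ (L M : ℕ) [NeZero L] [NeZero M] (β U μ : ℝ) (K : TrigPolyC4v) (R : RenConsts) (n : ℕ),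
      Pr.renorm L M β U μ K R n → FlowPieceJetsAt L M β U μ R n) :
    BetaSplitP Pr W := by
  refine betaSplitP_of_edgeClausesF (Pr := Pr) (sG := 3) (sQ := 9) (tG := 10 / 3) (tQ := 148 / 3) (tN := 15) (by norm_num) (by norm_num)
    (by norm_num) (by norm_num) (by norm_num) (by unfold klLegKappa; norm_num)
    (fun R => klE0 / (32 * R.Gfr 0 + 1)) (fun R hR => div_pos (by norm_num [klE0]) (by linarith [hR.2.2 0]))
    (fun L M _ _ G P Q β U μ j Qm k k' =>
      if 1 ≤ j then thermalBar G P U β j + legDressBarQ2 G P Q U j (legSliceCountT L β μ (klFlowFrameU L M β U μ j) j ![k', Qm - k', Qm - k, k]) +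
        (P.Klam * U) ^ 2 * (max (G.phGain j (klTorusNorm L (k - k'))) 0 + max (G.phGain j (klTorusNorm L (k + k' - Qm))) 0) +
        frameShiftBar P Q U j
      else legDressBarQ2 G P Q U 0 4)
    ?_ ?_ ?_ ?_ (fun L G P Q β U μ j Qm => 2 * klEdge G j (klTorusNorm L Qm)) ?_ hs ?_
  · -- nonnegativity
    intro L M _ _ G P Q β U μ j Qm k k' hG hP hQ
    have hCF : 0 ≤ G.CF := hG.2.2.2.2.2.2.2.2.2.2.2.2.2.1
    have hK0 : 0 ≤ P.Klam := zero_le_one.trans hP.1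
    split_ifs
    · exact add_nonneg (add_nonneg (add_nonneg (thermalBar_nonneg hCF P U β j) (legDressBarQ2_nonneg G hK0 hQ.2.1 U j _))
        (klbs9_X_nonneg G P U j _ _)) (frameShiftBar_nonneg hQ.2.1 U j)
    · exact legDressBarQ2_nonneg G hK0 hQ.2.1 U 0 _
  · -- per-scale size (`≤ 3·CF(Klam U)² + 9·CR·Klam³·U²`)
    intro L M _ _ G P Q β U μ j Qm k k' hG hP hQ hU hU1
    have hCF : 0 ≤ G.CF := hG.2.2.2.2.2.2.2.2.2.2.2.2.2.1
    have hK0 : 0 ≤ P.Klam := zero_le_one.trans hP.1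
    have hCR : 0 ≤ Q.CR := hQ.2.1
    have hcr3 := cr3_le hP.1 hCR hU1
    have hq30 : 0 ≤ Q.CR * P.Klam ^ 3 * U ^ 2 := by positivity
    have hg20 : 0 ≤ G.CF * (P.Klam * U) ^ 2 := by positivity
    split_ifs with hj
    · have h1 := thermalBar_le hCF P U β j
      have h2 := legDressBarQ2_le G hK0 hCR U j (legSliceCountT L β μ (klFlowFrameU L M β U μ j) j ![k', Qm - k', Qm - k, k])
      have h4 : (legSliceCountT L β μ (klFlowFrameU L M β U μ j) j ![k', Qm - k', Qm - k, k] : ℝ) ≤ 4 := by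
        exact_mod_cast legSliceCountT_le_four L β μ (klFlowFrameU L M β U μ j) j _
      have h3 : Q.CR * ((P.Klam * U) ^ 2 + (P.Klam * |U|) ^ 3) * (legSliceCountT L β μ (klFlowFrameU L M β U μ j) j ![k', Qm - k', Qm - k, k] : ℝ) ≤
          2 * Q.CR * P.Klam ^ 3 * U ^ 2 * 4 := mul_le_mul hcr3 h4 (Nat.cast_nonneg _) (by positivity)
      have h5 : (P.Klam * U) ^ 2 * (max (G.phGain j (klTorusNorm L (k - k'))) 0 + max (G.phGain j (klTorusNorm L (k + k' - Qm))) 0) ≤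
          2 * (G.CF * (P.Klam * U) ^ 2) := klbs9_X_le hG P U j (torusSupNorm_nonneg _) (torusSupNorm_nonneg _)
      have h6 := frameShiftBar_le_cube hP.1 hCR U j
      linarith
    · have h2 := legDressBarQ2_le G hK0 hCR U 0 4
      have h3 : Q.CR * ((P.Klam * U) ^ 2 + (P.Klam * |U|) ^ 3) * ((4 : ℕ) : ℝ) ≤ 2 * Q.CR * P.Klam ^ 3 * U ^ 2 * 4 := by
        rw [Nat.cast_ofNat]; nlinarith [hcr3]
      linarith
  · -- scale sums over `(t, n]`: the (D) count is summed along the flow frames with the rate read from the history below `n`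
    intro L M _ _ G P Q R β U μ K t n Qm k k' hG hP hQ hR hU hU1 hUR hn hHist
    have hCF : 0 ≤ G.CF := hG.2.2.2.2.2.2.2.2.2.2.2.2.2.1
    have hK0 : 0 ≤ P.Klam := zero_le_one.trans hP.1
    have hCR : 0 ≤ Q.CR := hQ.2.1
    have hcr3 := cr3_le hP.1 hCR hU1
    have hq30 : 0 ≤ Q.CR * P.Klam ^ 3 * U ^ 2 := by positivity
    have hGfr : 0 ≤ R.Gfr 0 := hR.2.2 0
    have hU32 : 32 * R.Gfr 0 * |U| ≤ klE0 := klbsF_rate_smallness hU hGfr hUR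
    have hJ : ∀ m < n, FlowPieceJetsAt L M β U μ R m := fun m hm => hr L M β U μ K R m (hHist m hm).2.1
    have heq : ∀ j ∈ Ioc t n, (if 1 ≤ j then thermalBar G P U β j +
        legDressBarQ2 G P Q U j (legSliceCountT L β μ (klFlowFrameU L M β U μ j) j ![k', Qm - k', Qm - k, k]) +
        (P.Klam * U) ^ 2 * (max (G.phGain j (klTorusNorm L (k - k'))) 0 + max (G.phGain j (klTorusNorm L (k + k' - Qm))) 0) +
        frameShiftBar P Q U j
        else legDressBarQ2 G P Q U 0 4) =
        thermalBar G P U β j + legDressBarQ2 G P Q U j (legSliceCountT L β μ (klFlowFrameU L M β U μ j) j ![k', Qm - k', Qm - k, k]) +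
        (P.Klam * U) ^ 2 * (max (G.phGain j (klTorusNorm L (k - k'))) 0 + max (G.phGain j (klTorusNorm L (k + k' - Qm))) 0) +
        frameShiftBar P Q U j := by
      intro j hj
      simp only [mem_Ioc] at hj
      rw [if_pos (by omega)]
    rw [sum_congr rfl heq, sum_add_distrib, sum_add_distrib, sum_add_distrib]
    have hsub : ∀ (f : ℕ → ℝ), (∀ j, 0 ≤ f j) → ∑ j ∈ Ioc t n, f j ≤ ∑ j ∈ range (n + 1), f j := fun f hf =>
      sum_le_sum_of_subset_of_nonneg (fun j hj => by simp only [mem_Ioc] at hj; exact mem_range.2 (by omega)) fun j _ _ => hf j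
    have h1 : ∑ j ∈ Ioc t n, thermalBar G P U β j ≤ 4 / 3 * (G.CF * (P.Klam * U) ^ 2) :=
      (hsub _ fun j => thermalBar_nonneg hCF P U β j).trans (thermalBar_sum_le hCF P U β hn)
    have h2 : ∑ j ∈ Ioc t n, legDressBarQ2 G P Q U j (legSliceCountT L β μ (klFlowFrameU L M β U μ j) j ![k', Qm - k', Qm - k, k]) ≤
        20 * (2 * Q.CR * P.Klam ^ 3 * U ^ 2) :=
      ((hsub _ fun j => legDressBarQ2_nonneg G hK0 hCR U j _).trans
          (legDressBarQ2_countT_flowFrameU_sum_le L M G hK0 hCR hJ hGfr hU32 _)).trans (by nlinarith [hcr3])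
    have h3 : ∑ j ∈ Ioc t n, (P.Klam * U) ^ 2 * (max (G.phGain j (klTorusNorm L (k - k'))) 0 + max (G.phGain j (klTorusNorm L (k + k' - Qm))) 0) ≤
        2 * (G.CF * (P.Klam * U) ^ 2) :=
      (hsub _ fun j => klbs9_X_nonneg G P U j _ _).trans
        (klbs9_X_sum_le hG P U (n + 1) (torusSupNorm_nonneg _) (torusSupNorm_nonneg _))
    have h4 : ∑ j ∈ Ioc t n, frameShiftBar P Q U j ≤ 4 / 3 * (Q.CR * P.Klam ^ 3 * U ^ 2) :=
      (hsub _ fun j => frameShiftBar_nonneg hCR U j).trans (sum_frameShiftBar_le_cube' hP.1 hCR U (n + 1))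
    linarith
  · -- scale sums `m ≤ n`: the scale-0 term plus the shifted inductive sums
    intro L M _ _ G P Q R β U μ K n Qm k k' hG hP hQ hR hU hU1 hUR hn hHist
    have hCF : 0 ≤ G.CF := hG.2.2.2.2.2.2.2.2.2.2.2.2.2.1
    have hK0 : 0 ≤ P.Klam := zero_le_one.trans hP.1
    have hCR : 0 ≤ Q.CR := hQ.2.1
    have hcr3 := cr3_le hP.1 hCR hU1
    have hq30 : 0 ≤ Q.CR * P.Klam ^ 3 * U ^ 2 := by positivity
    have hGfr : 0 ≤ R.Gfr 0 := hR.2.2 0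
    have hU32 : 32 * R.Gfr 0 * |U| ≤ klE0 := klbsF_rate_smallness hU hGfr hUR
    have hJ : ∀ m < n, FlowPieceJetsAt L M β U μ R m := fun m hm => hr L M β U μ K R m (hHist m hm).2.1
    have heq : ∀ i ∈ range n, (if 1 ≤ i + 1 then thermalBar G P U β (i + 1) +
        legDressBarQ2 G P Q U (i + 1) (legSliceCountT L β μ (klFlowFrameU L M β U μ (i + 1)) (i + 1) ![k', Qm - k', Qm - k, k]) +
        (P.Klam * U) ^ 2 * (max (G.phGain (i + 1) (klTorusNorm L (k - k'))) 0 + max (G.phGain (i + 1) (klTorusNorm L (k + k' - Qm))) 0) +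
        frameShiftBar P Q U (i + 1)
        else legDressBarQ2 G P Q U 0 4) =
        thermalBar G P U β (i + 1) +
        legDressBarQ2 G P Q U (i + 1) (legSliceCountT L β μ (klFlowFrameU L M β U μ (i + 1)) (i + 1) ![k', Qm - k', Qm - k, k]) +
        (P.Klam * U) ^ 2 * (max (G.phGain (i + 1) (klTorusNorm L (k - k'))) 0 + max (G.phGain (i + 1) (klTorusNorm L (k + k' - Qm))) 0) +
        frameShiftBar P Q U (i + 1) :=
      fun i _ => by rw [if_pos (by omega)]
    rw [if_neg (by omega), sum_congr rfl heq, sum_add_distrib, sum_add_distrib, sum_add_distrib]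
    have h0 := legDressBarQ2_le G hK0 hCR U 0 4
    have h0' : Q.CR * ((P.Klam * U) ^ 2 + (P.Klam * |U|) ^ 3) * ((4 : ℕ) : ℝ) ≤ 2 * Q.CR * P.Klam ^ 3 * U ^ 2 * 4 := by
      rw [Nat.cast_ofNat]; nlinarith [hcr3]
    have h1 : ∑ i ∈ range n, thermalBar G P U β (i + 1) ≤ 4 / 3 * (G.CF * (P.Klam * U) ^ 2) :=
      (sum_range_succ_shift_le (f := fun m => thermalBar G P U β m) (fun m => thermalBar_nonneg hCF P U β m) n).trans
        (thermalBar_sum_le hCF P U β hn)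
    have h2 : ∑ i ∈ range n, legDressBarQ2 G P Q U (i + 1)
        (legSliceCountT L β μ (klFlowFrameU L M β U μ (i + 1)) (i + 1) ![k', Qm - k', Qm - k, k]) ≤ 20 * (2 * Q.CR * P.Klam ^ 3 * U ^ 2) :=
      ((sum_range_succ_shift_le
          (f := fun m => legDressBarQ2 G P Q U m (legSliceCountT L β μ (klFlowFrameU L M β U μ m) m ![k', Qm - k', Qm - k, k]))
          (fun m => legDressBarQ2_nonneg G hK0 hCR U m _) n).trans
          (legDressBarQ2_countT_flowFrameU_sum_le L M G hK0 hCR hJ hGfr hU32 _)).trans (by nlinarith [hcr3])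
    have h3 : ∑ i ∈ range n, (P.Klam * U) ^ 2 *
        (max (G.phGain (i + 1) (klTorusNorm L (k - k'))) 0 + max (G.phGain (i + 1) (klTorusNorm L (k + k' - Qm))) 0) ≤
        2 * (G.CF * (P.Klam * U) ^ 2) :=
      (sum_range_succ_shift_le
          (f := fun m => (P.Klam * U) ^ 2 * (max (G.phGain m (klTorusNorm L (k - k'))) 0 + max (G.phGain m (klTorusNorm L (k + k' - Qm))) 0))
          (fun m => klbs9_X_nonneg G P U m _ _) n).trans
        (klbs9_X_sum_le hG P U (n + 1) (torusSupNorm_nonneg _) (torusSupNorm_nonneg _))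
    have h4 : ∑ i ∈ range n, frameShiftBar P Q U (i + 1) ≤ 4 / 3 * (Q.CR * P.Klam ^ 3 * U ^ 2) :=
      (sum_range_succ_shift_le (f := fun m => frameShiftBar P Q U m) (fun m => frameShiftBar_nonneg hCR U m) n).trans
        (sum_frameShiftBar_le_cube' hP.1 hCR U (n + 1))
    linarith
  · -- the sign-defect allowance `2·klEdge` is in-class scale-summable (verbatim from p475114)
    intro L G P Q β U μ t Qm hG hP hQ hU hU1 ht hQt
    have hbhi : 0 ≤ G.bhi := hG.2.2.1.trans hG.2.2.2.1
    have h1 : ∑ i ∈ range t, 2 * klEdge G (i + 1) (klTorusNorm L Qm) =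
        2 * G.bhi * ∑ i ∈ range t, min 1 ((2 * (4 : ℝ) ^ 5) * klTorusNorm L Qm * (4 : ℝ) ^ (i + 1)) := by
      rw [mul_sum]
      refine sum_congr rfl fun i _ => ?_
      rw [klEdge_eq_pow, show 2 * klTorusNorm L Qm * (4 : ℝ) ^ (i + 1 + 5) = (2 * (4 : ℝ) ^ 5) * klTorusNorm L Qm * (4 : ℝ) ^ (i + 1) by
        rw [pow_add]; ring]
      ring
    have h2 : ∑ i ∈ range t, min 1 ((2 * (4 : ℝ) ^ 5) * klTorusNorm L Qm * (4 : ℝ) ^ (i + 1)) ≤ 22 / 3 :=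
      (sum_min_one_edge_le (s := 6) (torusSupNorm_nonneg _) (by norm_num) hQt).trans (by norm_num)
    rw [h1]
    refine (mul_le_mul_of_nonneg_left h2 (by positivity : (0 : ℝ) ≤ 2 * G.bhi)).trans ?_
    linarith
  · -- the engine slot yields `EngineBoundsAtV17F2`: project the clauses child 1 reads ((E2-F2): UV / signed ladder; (E2″-F); (E4) at `K_n`; (E5-F))
    intro L M _ _ G P Q β U μ K n h
    have h' : EngineBoundsAtV17F2 L M G P Q β U μ n := he L M G P Q β U μ K n h
    refine ⟨fun hn0 Qm k hk k' hk' => ?_, fun hn1 Qm hQ => ?_, fun hn1 Qm k hk k' hk' => ?_, h'.2.2.2.2.2.2.1, h'.2.2.2.2.2.2.2⟩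
    · rw [if_neg (by omega)]
      exact h'.2.2.1.1 hn0 Qm k hk k' hk'
    · obtain ⟨w, hwabs, hwneg, N, hN, hb⟩ := h'.2.2.1.2 hn1 Qm hQ
      refine ⟨w, hwabs, hwneg, N, hN, fun k hk k' hk' => (hb k hk k' hk').trans ?_⟩
      rw [if_pos hn1]
      have hx := klbs9_X_le_X G P U n (klTorusNorm L (k - k')) (klTorusNorm L (k + k' - Qm))
      linarith
    · have hx := klbs9_X_nonneg G P U n (klTorusNorm L (k - k')) (klTorusNorm L (k + k' - Qm))
      refine (h'.2.2.2.1 hn1 Qm k hk k' hk').trans ?_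
      rw [if_pos hn1]
      linarith

/-! ## §3 Child 1 at the cured gen-8 bundle -/

/-- **Child 1 at the bundle `klPredsV17F2`, every covariance window**: `split = BetaSplitAtV17F`, `engine = EngineBoundsAtV17F2` by `rfl`; the renorm slot
`RenormFlowAtV17F` carries (I-F jets) as its second conjunct. -/
theorem betaSplitP_klPredsV17F2 (W : Set ℝ) : BetaSplitP klPredsV17F2 W :=
  betaSplitP_of_slotsV17F2 (Pr := klPredsV17F2) (fun _ _ _ _ _ _ _ _ _ _ _ _ h => h) (fun _ _ _ _ _ _ _ _ _ _ _ _ h => h)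
    (fun _ _ _ _ _ _ _ _ _ _ h => h.2.1)

end Summit.HubbardSuperconductivity.HubbardSuperconductivity.Theorems.KLRegimeSplit

end
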